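import Literature.Barriers.BirchSwinnertonDyer.RankNotSumOfLocalInvariantsK1Dyadic
import Literature.Barriers.BirchSwinnertonDyer.RankNotSumOfLocalInvariantsDescentNeg1
import Literature.Barriers.BirchSwinnertonDyer.RankNotSumOfLocalInvariantsF4TwistsQ
import Literature.NumberTheory.EllipticCurves.TwoDescentInertPlace
import HarnessLib

/-!
# `rk E(F₄)` for `E = 480a1` via `ℚ(√-1)`: the `2`-descent of `E^{(2993)}` over `ℚ(√-1)` — `rk ≤ 3`

The last upper bound `hU2993 : rk E^{(2993)}(ℚ(√-1)) ≤ 3` of the tree's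
`descent_480a1_F4_of_upper_bounds` / `rank_480a1_F4_of_upper_bounds`
(`RankNotSumOfLocalInvariantsF4TwistsQ.lean`) for the rank leaf `rk E(F₄) = 6` of
T. Dokchitser–V. Dokchitser, *A note on the Mordell–Weil rank modulo n*, J. Number Theory 131 (2011),
proof of Thm. 2 (`E = 480a1`, `F₄ = ℚ(√-1, √41, √73)`, "2-descent … over all minimal non-trivial
subfields"; `ℚ(√-1)` is the subfield on which `rk E^{(2993)} = rk E^{(2993)}(ℚ) + rk E^{(-2993)}(ℚ)
= 1 + 2`):

* `mordellWeilRank_twist2993_K1_le : ((curve480a1.quadraticTwist 2993).baseChange K1).mordellWeilRank ≤ 3`.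

A COMPLETE `2`-DESCENT OVER `K1 = ℚ(√-1)` of `E^{(d)} : y² = x(x + 2d)(x - 3d)`, `d = 2993 = 41·73`,
assembled from the tree's groundwork files `RankNotSumOfLocalInvariantsK1{Arithmetic, Selmer,
Digits, Tables, LocalOdd, Dyadic}.lean` (the group `K1(S,2) = ⟨i, 1+i, 3, 2±i, 5±4i, 8±3i⟩`, the
square-class characters `MulBit`, their tables, the local conditions at `2±i`, `5±4i`, `8±3i` and
at the ramified prime `1+i`) together with the local conditions at the INERT prime `3`
(`OddPlace.local_conditions_of_mult` for the place `inertPlace 3 (-1)` of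
`TwoDescentInertPlace.lean`: `ord₃(x + 2d)` is even and `N(x + 2d)` is a square mod `3`):

* the coordinates character `ψ : E^{(d)}(K1) → 𝔽₂⁹ × 𝔽₂⁹`, `P ↦` the exponent vectors
  `(a; e₀, …, e₇)` of the classes of `x` and `x + 2d` on the basis `i, 1+i, 3, 2+i, 2-i, 5+4i,
  5-4i, 8+3i, 8-3i` of `K1(S, 2)` (`K1.exists_sq_decomposition`; read through the characters
  `κ = re + ord_{2+i} + ord_{2-i} + ord_{8+3i} + ord_{8-3i}` — which is `1` on `i` and `0` on the
  other generators — and `ord_{gen k}`);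
* `ψ` has kernel in `2E(K1)` and image in the kernel `TK` of thirteen `𝔽₂`-linear local
  conditions `L` (two at each of `2+i`, `2-i`, `5-4i`, `8+3i`, `(3)`, one at `5+4i`, `8-3i` and
  one dyadic), and `#TK ≤ 2¹⁸/2¹³ = 32` because `L` has rank `13` — certified by thirteen explicit
  vectors on which `R ∘ L` takes the thirteen unit vectors, for an explicit `R` (no enumeration of
  `𝔽₂¹⁸`);

whence `2^{r+2} ≤ 32` (`mordellWeilRank_le_of_range_subset`). (`#Sel₂(E^{(2993)}/ℚ(√-1)) = 32`, so
the bound is sharp; over `ℚ` the `2`-Selmer bounds of `E^{(±2993)}` are not.)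

## References

* T. Dokchitser, V. Dokchitser, *A note on the Mordell–Weil rank modulo n*, J. Number Theory 131
  (2011) 1833–1839, proof of Thm. 2. [DokchitserDokchitser2011RankModN]
* J. H. Silverman, *The Arithmetic of Elliptic Curves*, 2nd ed., GTM 106 (2009), Prop. X.1.4,
  Example X.1.5, Thm. X.1.1(c). [SilvermanAEC2009]
-/

noncomputable section

open scoped Classical

open QuadraticAlgebra IsDedekindDomain IsDedekindDomain.HeightOneSpectrum WithZero
open WeierstrassCurve WeierstrassCurve.Affine WeierstrassCurve.Affine.Point
open Literature.NumberTheory.EllipticCurves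
open Literature.NumberTheory.EllipticCurves.TwoDescentLocal
open Literature.NumberTheory.EllipticCurves.KramerTwoDescent

attribute [-instance] instDecidableEqQuadraticAlgebra

namespace Literature.Barriers.BirchSwinnertonDyer

namespace DokchitserDokchitser2011

namespace Descent2993

/-- Mathlib's Gaussian integers `ℤ√-1` (the notation `ℤ[i]` is local to Mathlib's file). -/
local notation "ℤ[i]" => GaussianInt

/-! ### The curve `E^{(2993)}` over `K1` -/

/-- `E^{(2993)}` over `K1 = ℚ(√-1)` (local notation). -/
local notation "E'" => WeierstrassCurve.baseChange (curve480a1.quadraticTwist (2993 : ℚ)) K1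

/-- `d = 2993`. -/
local notation "𝕕" => (2993 : ℤ)

/-- `E^{(2993)}` is elliptic over `ℚ`. [folklore] -/
instance isElliptic_twist_2993 : (curve480a1.quadraticTwist (2993 : ℚ)).IsElliptic :=
  isElliptic_twist (by norm_num)

/-- `E^{(2993)}` is elliptic over `K1`. [folklore] -/
instance isElliptic_E' : (E').IsElliptic :=
  inferInstanceAs ((curve480a1.quadraticTwist (2993 : ℚ)).map (algebraMap ℚ K1)).IsElliptic

/-- The coefficients of `E^{(2993)}` over `K1`. [folklore] -/
theorem coeffs_E' : (E').a₁ = 0 ∧ (E').a₂ = -2993 ∧ (E').a₃ = 0 ∧ (E').a₄ = -6 * 2993 ^ 2 ∧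
    (E').a₆ = 0 := by
  refine ⟨?_, ?_, ?_, ?_, ?_⟩
  · show ((curve480a1.quadraticTwist (2993 : ℚ)).map (algebraMap ℚ K1)).a₁ = 0
    rw [WeierstrassCurve.map_a₁, twist_a₁, _root_.map_zero]
  · show ((curve480a1.quadraticTwist (2993 : ℚ)).map (algebraMap ℚ K1)).a₂ = -2993
    rw [WeierstrassCurve.map_a₂, twist_a₂, map_neg, map_ofNat]
  · show ((curve480a1.quadraticTwist (2993 : ℚ)).map (algebraMap ℚ K1)).a₃ = 0
    rw [WeierstrassCurve.map_a₃, twist_a₃, _root_.map_zero]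
  · show ((curve480a1.quadraticTwist (2993 : ℚ)).map (algebraMap ℚ K1)).a₄ = -6 * 2993 ^ 2
    rw [WeierstrassCurve.map_a₄, twist_a₄, map_mul, map_neg, map_pow, map_ofNat, map_ofNat]
  · show ((curve480a1.quadraticTwist (2993 : ℚ)).map (algebraMap ℚ K1)).a₆ = 0
    rw [WeierstrassCurve.map_a₆, twist_a₆, _root_.map_zero]

/-- The affine equation of `E^{(2993)}` over `K1`: `y² = x³ - d x² - 6 d² x`. [folklore] -/
theorem equation_iff_E' (x y : K1) :
    (E').toAffine.Equation x y ↔ y ^ 2 = x ^ 3 - 2993 * x ^ 2 - 6 * 2993 ^ 2 * x := by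
  obtain ⟨h1, h2, h3, h4, h6⟩ := coeffs_E'
  rw [WeierstrassCurve.Affine.equation_iff]
  rw [show (E').toAffine.a₁ = (E').a₁ from rfl, show (E').toAffine.a₂ = (E').a₂ from rfl,
    show (E').toAffine.a₃ = (E').a₃ from rfl, show (E').toAffine.a₄ = (E').a₄ from rfl,
    show (E').toAffine.a₆ = (E').a₆ from rfl, h1, h2, h3, h4, h6]
  constructor <;> intro h <;> linear_combination h

/-- Over `K1` every solution of the equation is nonsingular, in product form:
`y² = x (x + 2d)(x - 3d)`. [folklore] -/
theorem nonsingular_iff_E' (x y : K1) :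
    (E').toAffine.Nonsingular x y ↔ y ^ 2 = x * (x + 2 * 2993) * (x - 3 * 2993) := by
  rw [← equation_iff_nonsingular, equation_iff_E']
  constructor <;> intro h <;> linear_combination h

/-- Rational `2`-torsion `0, -2d, 3d` of `E^{(2993)}` over `K1`. [folklore] -/
theorem splitTwoTorsion_E' : (E').toAffine.SplitTwoTorsion 0 (-2 * 2993) (3 * 2993) := by
  obtain ⟨h1, h2, h3, h4, h6⟩ := coeffs_E'
  refine ⟨?_, ?_, ?_⟩
  · rw [show (E').toAffine.b₂ = (E').b₂ from rfl, WeierstrassCurve.b₂, h1, h2]; norm_num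
  · rw [show (E').toAffine.b₄ = (E').b₄ from rfl, WeierstrassCurve.b₄, h1, h3, h4]; norm_num
  · rw [show (E').toAffine.b₆ = (E').b₆ from rfl, WeierstrassCurve.b₆, h3, h6]; norm_num

/-- On `E^{(2993)}/K1`, `y = 0` forces `x ∈ {0, -2d, 3d}`. [folklore] -/
theorem x_eq_of_y_eq_zero {x : K1} (hP : (E').toAffine.Nonsingular x 0) :
    x = 0 ∨ x = -2 * 2993 ∨ x = 3 * 2993 := by
  have h := (nonsingular_iff_E' x 0).mp hP
  rw [zero_pow two_ne_zero, zero_eq_mul, mul_eq_zero] at h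
  rcases h with (h | h) | h
  · exact Or.inl h
  · exact Or.inr (Or.inl (by linear_combination h))
  · exact Or.inr (Or.inr (by linear_combination h))

/-! ### Integral encoding of a `K1`-point -/

/-- **Integral encoding.** For `x, y ∈ K1` with `y ≠ 0` on `y² = x(x + 2d)(x - 3d)` there are
Gaussian integers `z, n, w, m` with `n, m, w ≠ 0`, `x = toK1 z / toK1 n`,
`x + 2d = toK1 (z + 2dn) / toK1 n` and `w² n³ = m² z (z + 2dn)(z - 3dn)` — the form in which the
tree's local lemmas (`five_a_conditions`, …, `local_dyadic`) are stated. [folklore] -/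
theorem exists_encoding {x y : K1} (hy : y ≠ 0) (h : y ^ 2 = x * (x + 2 * 2993) * (x - 3 * 2993)) :
    ∃ z n w m : ℤ[i], n ≠ 0 ∧ m ≠ 0 ∧ w ≠ 0 ∧ x = toK1 z / toK1 n ∧
      x + 2 * 2993 = toK1 (z + 2 * 𝕕 * n) / toK1 n ∧
      w ^ 2 * n ^ 3 = m ^ 2 * (z * (z + 2 * 𝕕 * n) * (z - 3 * 𝕕 * n)) := by
  obtain ⟨z, N, hN, hx⟩ := K1.exists_eq_toK1_div_nat x
  obtain ⟨w, M, hM, hyw⟩ := K1.exists_eq_toK1_div_nat y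
  have hN0 : (N : ℤ[i]) ≠ 0 := by exact_mod_cast hN.ne'
  have hM0 : (M : ℤ[i]) ≠ 0 := by exact_mod_cast hM.ne'
  have hNK : (N : K1) ≠ 0 := by exact_mod_cast hN.ne'
  have hMK : (M : K1) ≠ 0 := by exact_mod_cast hM.ne'
  have hw : w ≠ 0 := by
    rintro rfl
    rw [_root_.map_zero, zero_div] at hyw
    exact hy hyw
  refine ⟨z, N, w, M, hN0, hM0, hw, by rw [toK1_natCast]; exact hx, ?_, ?_⟩
  · rw [hx, map_add, map_mul, map_mul, toK1_natCast, map_ofNat, map_intCast]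
    field_simp
    push_cast; ring
  · apply toK1_injective
    have key : (toK1 w) ^ 2 * (N : K1) ^ 3 = (M : K1) ^ 2 * (toK1 z * (toK1 z + 2 * 2993 * N) *
        (toK1 z - 3 * 2993 * N)) := by
      have e1 : y = toK1 w / M := hyw
      have e2 : x = toK1 z / N := hx
      rw [e1, e2] at h
      field_simp at h
      linear_combination h
    simp only [map_mul, map_pow, map_add, map_sub, toK1_natCast, map_intCast, map_ofNat]
    push_cast
    linear_combination key

/-- **Character values on an encoded point**: for a square-class character `χ` (`MulBit`),
`χ(x) = χ z + χ n` and `χ(x + 2d) = χ(z + 2dn) + χ n`. [folklore] -/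
theorem onK1_encoding (χ : MulBit) {x : K1} {z n : ℤ[i]} (hn : n ≠ 0) (hz : z ≠ 0)
    (hz2 : z + 2 * 𝕕 * n ≠ 0) (hx : x = toK1 z / toK1 n)
    (hx2 : x + 2 * 2993 = toK1 (z + 2 * 𝕕 * n) / toK1 n) :
    χ.onK1 x = χ z + χ n ∧ χ.onK1 (x + 2 * 2993) = χ (z + 2 * 𝕕 * n) + χ n := by
  rw [hx2, hx]
  exact ⟨χ.onK1_div hz hn, χ.onK1_div hz2 hn⟩

/-! ### The inert prime `3`: an odd place of `K1` and its two characters as `MulBit`s -/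

/-- `v₃(-1) = 0` and `-1 ≡ 2` is a non-square mod `3`: `3` is inert in `K1`. [folklore] -/
theorem inert3_data : padicValRat 3 (-1 : ℚ) = 0 ∧ ¬ IsSquare (res 3 (-1 : ℚ)) := by
  refine ⟨by rw [padicValRat.neg, padicValRat.one], ?_⟩
  rw [res_three_values.1]
  exact isSquare_values.1

/-- The inert place `(3)` of `K1 = ℚ(√-1)` (`ord_(3) = v₃ ∘ N / 2`, residue bit `qrBit 3 ∘ N`). [folklore] -/
def 𝔴 : OddPlace K1 := inertPlace 3 (-1) inert3_data.1 inert3_data.2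

/-- `𝔴.v z = v₃(N z)/2`, `𝔴.χ z = qrBit 3 (N z)`. [folklore] -/
theorem 𝔴_v_χ (z : K1) : 𝔴.v z = padicValRat 3 z.norm / 2 ∧ 𝔴.χ z = qrBit 3 z.norm := ⟨rfl, rfl⟩

/-- Norms of rational integers in `K1`. [folklore] -/
theorem norm_intCast_K1 (c : ℤ) : (c : K1).norm = (c : ℚ) ^ 2 := by
  rw [norm_def]; simp [re_intCast, im_intCast, sq]

/-- `ord_(3)` and the residue bit of a rational integer prime to `3`: both `0`; and
`ord_(3)(3c) = 1` for `3 ∤ c`. [folklore] -/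
theorem 𝔴_intCast {c : ℤ} (hc : ¬ (3 : ℤ) ∣ c) (hc0 : c ≠ 0) :
    𝔴.v (c : K1) = 0 ∧ 𝔴.χ (c : K1) = 0 ∧ 𝔴.v ((3 * c : ℤ) : K1) = 1 := by
  have hv : padicValRat 3 (c : ℚ) = 0 := by
    rw [padicValRat.of_int, padicValInt.eq_zero_of_not_dvd hc]; rfl
  have hc0' : (c : ℚ) ≠ 0 := by exact_mod_cast hc0
  refine ⟨?_, ?_, ?_⟩
  · rw [(𝔴_v_χ _).1, norm_intCast_K1, padicValRat.pow, hv]; rfl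
  · rw [(𝔴_v_χ _).2, norm_intCast_K1, qrBit_sq]
  · rw [(𝔴_v_χ _).1, norm_intCast_K1, padicValRat.pow, Int.cast_mul,
      padicValRat.mul (by norm_num) hc0', hv, add_zero, show ((3 : ℤ) : ℚ) = ((3 : ℕ) : ℚ) by norm_num,
      padicValRat.self (by norm_num)]
    rfl

/-- **The local conditions at the inert prime `(3)`** for `E^{(2993)}` over `K1`
(`3 ∥ e₁ - e₃ = -3d`, isolated root `e₂ = -2d`; `OddPlace.local_conditions_of_mult`):
`ord_(3)(x + 2d)` is even and `N(x + 2d)` is a square mod `3`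
(`χ(x + 2d) = parity(x) · χ(2d)` with `χ(2d) = qrBit 3 ((2d)²) = 0`).
[cite: SilvermanAEC2009, Prop. X.1.4] -/
theorem three_conditions {x y : K1} (hy : y ≠ 0)
    (h : y ^ 2 = x * (x + 2 * 2993) * (x - 3 * 2993)) :
    Even (𝔴.v (x + 2 * 2993)) ∧ 𝔴.χ (x + 2 * 2993) = 0 := by
  obtain ⟨v2d, χ2d, -⟩ := 𝔴_intCast (c := 2 * 2993) (by decide) (by decide)
  obtain ⟨v5d, -, -⟩ := 𝔴_intCast (c := -(5 * 2993)) (by decide) (by decide)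
  obtain ⟨-, -, v3d⟩ := 𝔴_intCast (c := -2993) (by decide) (by decide)
  have hloc := OddPlace.local_conditions_of_mult (𝔳 := 𝔴) (e₁ := (-2 * 2993 : K1)) (e₂ := 0)
    (e₃ := 3 * 2993) (x := x) (y := y)
    (by rw [show (-2 * 2993 : K1) - 0 = -((2 * 2993 : ℤ) : K1) by push_cast; ring, 𝔴.v_neg]; exact v2d)
    (by rw [show (-2 * 2993 : K1) - 3 * 2993 = ((-(5 * 2993) : ℤ) : K1) by push_cast; ring]; exact v5d)
    (by rw [show (0 : K1) - 3 * 2993 = ((3 * -2993 : ℤ) : K1) by push_cast; ring]; exact v3d)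
    (by norm_num) (by norm_num) (by norm_num) hy (by rw [h]; ring)
  rw [show x - -2 * 2993 = x + 2 * 2993 by ring,
    show (0 : K1) - -2 * 2993 = ((2 * 2993 : ℤ) : K1) by push_cast; ring, χ2d, mul_zero] at hloc
  exact hloc

/-- **`ord_(3) (mod 2)` as a `MulBit`** (through `toK1`). [folklore] -/
def par3 : MulBit where
  toFun z := 𝔴.parity (toK1 z)
  map_mul' hz hw := by rw [map_mul]; exact 𝔴.parity_mul (toK1_ne_zero hz) (toK1_ne_zero hw)

/-- **The residue bit at `(3)`** (`N z` a non-square mod `3`) as a `MulBit`. [folklore] -/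
def chi3 : MulBit where
  toFun z := 𝔴.χ (toK1 z)
  map_mul' hz hw := by rw [map_mul]; exact 𝔴.χ_mul (toK1_ne_zero hz) (toK1_ne_zero hw)

/-- `par3`, `chi3` on `K1` are the parity and the residue bit of the place `(3)`. [folklore] -/
theorem par3_chi3_onK1 {x : K1} (hx : x ≠ 0) : par3.onK1 x = 𝔴.parity x ∧ chi3.onK1 x = 𝔴.χ x := by
  have hden : ((MulBit.den x : ℕ) : ℤ[i]) ≠ 0 := by exact_mod_cast (MulBit.den_pos x).ne'
  have hnum : MulBit.num x ≠ 0 := MulBit.num_ne_zero hx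
  have hd' : toK1 (MulBit.den x : ℤ[i]) ≠ 0 := toK1_ne_zero hden
  have e := MulBit.eq_num_div_den x
  rw [← toK1_natCast] at e
  constructor
  · show 𝔴.parity (toK1 (MulBit.num x)) + 𝔴.parity (toK1 (MulBit.den x : ℤ[i])) = 𝔴.parity x
    conv_rhs => rw [e]
    rw [𝔴.parity_def, 𝔴.parity_def, 𝔴.parity_def, 𝔴.v_div (toK1_ne_zero hnum) hd', Int.cast_sub,
      sub_eq_add_neg, ZMod.neg_eq_self_mod_two]
  · show 𝔴.χ (toK1 (MulBit.num x)) + 𝔴.χ (toK1 (MulBit.den x : ℤ[i])) = 𝔴.χ x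
    conv_rhs => rw [e]
    rw [𝔴.χ_div (toK1_ne_zero hnum) hd']

/-- The table of `par3` and `chi3` on `i` and the generators (norms `1; 2, 9, 5, 5, 41, 41, 73, 73`):
`par3 = [0; 0,1,0,0,0,0,0,0]`, `chi3 = [0; 1,0,1,1,1,1,0,0]`. [folklore] -/
theorem par3_chi3_table :
    (par3 gI = 0 ∧ ∀ j : Fin 8, par3 (gen j) = (![0, 1, 0, 0, 0, 0, 0, 0] : Fin 8 → ZMod 2) j) ∧
    (chi3 gI = 0 ∧ ∀ j : Fin 8, chi3 (gen j) = (![1, 0, 1, 1, 1, 1, 0, 0] : Fin 8 → ZMod 2) j) := by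
  obtain ⟨t1, t2, t3, t5, t41, t73⟩ := qrBit_three_values
  have hv : ∀ {q : ℤ}, ¬ (3 : ℤ) ∣ q → padicValRat 3 (q : ℚ) = 0 := fun hq => by
    rw [padicValRat.of_int, padicValInt.eq_zero_of_not_dvd hq]; rfl
  have nrm : ∀ a b : ℤ, (toK1 ⟨a, b⟩).norm = (a : ℚ) ^ 2 + (b : ℚ) ^ 2 := by
    intro a b; rw [toK1_mk, norm_def]; simp; ring
  have P : ∀ a b : ℤ, par3 ⟨a, b⟩ = ((padicValRat 3 ((a : ℚ) ^ 2 + (b : ℚ) ^ 2) / 2 : ℤ) : ZMod 2) := by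
    intro a b; show 𝔴.parity (toK1 ⟨a, b⟩) = _; rw [𝔴.parity_def, (𝔴_v_χ _).1, nrm]
  have X : ∀ a b : ℤ, chi3 ⟨a, b⟩ = qrBit 3 ((a : ℚ) ^ 2 + (b : ℚ) ^ 2) := by
    intro a b; show 𝔴.χ (toK1 ⟨a, b⟩) = _; rw [(𝔴_v_χ _).2, nrm]
  obtain ⟨hg0, hg1, hg2, hg3, hg4, hg5, hg6, hg7⟩ := gen_apply
  have e2 : (2 : ℚ) = ((2 : ℤ) : ℚ) := by norm_num
  have e5 : (5 : ℚ) = ((5 : ℤ) : ℚ) := by norm_num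
  have e41 : (41 : ℚ) = ((41 : ℤ) : ℚ) := by norm_num
  have e73 : (73 : ℚ) = ((73 : ℤ) : ℚ) := by norm_num
  refine ⟨⟨?_, fun j => ?_⟩, ⟨?_, fun j => ?_⟩⟩
  · show par3 ⟨0, 1⟩ = 0
    rw [P]; norm_num
  · fin_cases j
    · show par3 (gen 0) = 0
      rw [hg0, show g2 = (⟨1, 1⟩ : ℤ[i]) from rfl, P]; norm_num; rw [e2, hv (by decide)]; rfl
    · show par3 (gen 1) = 1
      rw [hg1, show (3 : ℤ[i]) = (⟨3, 0⟩ : ℤ[i]) from rfl, P]; norm_num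
      rw [show (9 : ℚ) = ((3 : ℕ) : ℚ) ^ 2 by norm_num, padicValRat.pow, padicValRat.self (by norm_num)]
      rfl
    · show par3 (gen 2) = 0
      rw [hg2, show g5a = (⟨2, 1⟩ : ℤ[i]) from rfl, P]; norm_num; rw [e5, hv (by decide)]; rfl
    · show par3 (gen 3) = 0
      rw [hg3, show g5b = (⟨2, -1⟩ : ℤ[i]) from rfl, P]; norm_num; rw [e5, hv (by decide)]; rfl
    · show par3 (gen 4) = 0
      rw [hg4, show g41a = (⟨5, 4⟩ : ℤ[i]) from rfl, P]; norm_num; rw [e41, hv (by decide)]; rfl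
    · show par3 (gen 5) = 0
      rw [hg5, show g41b = (⟨5, -4⟩ : ℤ[i]) from rfl, P]; norm_num; rw [e41, hv (by decide)]; rfl
    · show par3 (gen 6) = 0
      rw [hg6, show g73a = (⟨8, 3⟩ : ℤ[i]) from rfl, P]; norm_num; rw [e73, hv (by decide)]; rfl
    · show par3 (gen 7) = 0
      rw [hg7, show g73b = (⟨8, -3⟩ : ℤ[i]) from rfl, P]; norm_num; rw [e73, hv (by decide)]; rfl
  · show chi3 ⟨0, 1⟩ = 0
    rw [X]; norm_num; rw [show (1 : ℚ) = 1 ^ 2 by norm_num, qrBit_sq]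
  · fin_cases j
    · show chi3 (gen 0) = 1
      rw [hg0, show g2 = (⟨1, 1⟩ : ℤ[i]) from rfl, X]; norm_num; exact t2
    · show chi3 (gen 1) = 0
      rw [hg1, show (3 : ℤ[i]) = (⟨3, 0⟩ : ℤ[i]) from rfl, X]; norm_num
      rw [show (9 : ℚ) = 3 ^ 2 by norm_num, qrBit_sq]
    · show chi3 (gen 2) = 1
      rw [hg2, show g5a = (⟨2, 1⟩ : ℤ[i]) from rfl, X]; norm_num; exact t5
    · show chi3 (gen 3) = 1
      rw [hg3, show g5b = (⟨2, -1⟩ : ℤ[i]) from rfl, X]; norm_num; exact t5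
    · show chi3 (gen 4) = 1
      rw [hg4, show g41a = (⟨5, 4⟩ : ℤ[i]) from rfl, X]; norm_num; exact t41
    · show chi3 (gen 5) = 1
      rw [hg5, show g41b = (⟨5, -4⟩ : ℤ[i]) from rfl, X]; norm_num; exact t41
    · show chi3 (gen 6) = 0
      rw [hg6, show g73a = (⟨8, 3⟩ : ℤ[i]) from rfl, X]; norm_num; exact t73
    · show chi3 (gen 7) = 0
      rw [hg7, show g73b = (⟨8, -3⟩ : ℤ[i]) from rfl, X]; norm_num; exact t73

/-! ### The coordinate characters and linear forms -/

/-- **`κ = re + ord_{2+i} + ord_{2-i} + ord_{8+3i} + ord_{8-3i}`**, the square-class character detecting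
the unit `i`: `κ(i) = 1`, `κ(gen j) = 0`. [folklore] -/
def κ : MulBit where
  toFun z := MulBit.dyRe z + MulBit.ofPrime g5a prime_g5a z + MulBit.ofPrime g5b prime_g5b z +
    MulBit.ofPrime g73a prime_g73a z + MulBit.ofPrime g73b prime_g73b z
  map_mul' hz hw := by
    rw [MulBit.map_mul _ hz hw, MulBit.map_mul _ hz hw, MulBit.map_mul _ hz hw, MulBit.map_mul _ hz hw,
      MulBit.map_mul _ hz hw]
    ring

/-- The table of `κ`: `1` on `i`, `0` on the generators. [folklore] -/
theorem κ_table : κ gI = 1 ∧ ∀ j : Fin 8, κ (gen j) = 0 := by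
  obtain ⟨rI, rg⟩ := dyRe_table
  have hI : ∀ k : Fin 8, MulBit.ofPrime (gen k) (prime_gen k) gI = 0 := ofPrime_gen_gI
  have hg : ∀ k j : Fin 8, MulBit.ofPrime (gen k) (prime_gen k) (gen j) = if j = k then 1 else 0 :=
    ofPrime_gen_gen
  constructor
  · show MulBit.dyRe gI + MulBit.ofPrime (gen 2) (prime_gen 2) gI + MulBit.ofPrime (gen 3) (prime_gen 3) gI +
      MulBit.ofPrime (gen 6) (prime_gen 6) gI + MulBit.ofPrime (gen 7) (prime_gen 7) gI = 1
    rw [rI, hI, hI, hI, hI]; decide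
  · intro j
    show MulBit.dyRe (gen j) + MulBit.ofPrime (gen 2) (prime_gen 2) (gen j) +
      MulBit.ofPrime (gen 3) (prime_gen 3) (gen j) + MulBit.ofPrime (gen 6) (prime_gen 6) (gen j) +
      MulBit.ofPrime (gen 7) (prime_gen 7) (gen j) = 0
    rw [rg, hg, hg, hg, hg]
    fin_cases j <;> decide

/-- A table of values on `i` and the eight generators. [folklore] -/
abbrev Tab : Type := ZMod 2 × (Fin 8 → ZMod 2)

/-- The table of a `MulBit`. [folklore] -/
def tabOf (χ : MulBit) : Tab := (χ gI, fun k => χ (gen k))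

/-- **The linear form of a table** on coordinates `u = (a; e₀, …, e₇) ∈ 𝔽₂⁹`:
`a t(i) + Σ eₖ t(gen k)`. [folklore] -/
def lin (t : Tab) (u : Fin 9 → ZMod 2) : ZMod 2 :=
  u 0 * t.1 + (u 1 * t.2 0 + u 2 * t.2 1 + u 3 * t.2 2 + u 4 * t.2 3 + u 5 * t.2 4 + u 6 * t.2 5 +
    u 7 * t.2 6 + u 8 * t.2 7)

/-- `lin t` is additive. [folklore] -/
theorem lin_add (t : Tab) (u u' : Fin 9 → ZMod 2) : lin t (u + u') = lin t u + lin t u' := by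
  simp only [lin, Pi.add_apply]; ring

/-- `lin t 0 = 0`. [folklore] -/
theorem lin_zero (t : Tab) : lin t 0 = 0 := by simp [lin]

/-- The coordinates `(a; e₀, …, e₇) ∈ 𝔽₂⁹` of a decomposition `i^a ∏ (gen k)^(e k)`. [folklore] -/
def coords (a : ℕ) (e : Fin 8 → ℕ) : Fin 9 → ZMod 2 := Fin.cons (a : ZMod 2) (fun k => (e k : ZMod 2))

/-- **A square-class character in coordinates**: on `x = toK1 (i^a ∏ (gen k)^(e k)) · t²`,
`χ(x) = lin (tabOf χ) (coords a e)`. [folklore] -/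
theorem onK1_eq_lin (χ : MulBit) (a : ℕ) (e : Fin 8 → ℕ) {t : K1} (ht : t ≠ 0) :
    χ.onK1 (toK1 (gI ^ a * genProd e) * t ^ 2) = lin (tabOf χ) (coords a e) := by
  rw [χ.onK1_decomposition a e ht, lin, tabOf, coords, Fin.sum_univ_eight]
  simp only [Fin.cons_zero]
  rfl

/-- The tables of the parities at the generators. [folklore] -/
def To (k : Fin 8) : Tab := (0, fun j => if j = k then 1 else 0)

/-- `tabOf (ord_{gen k}) = To k`. [folklore] -/
theorem tabOf_ofPrime (k : Fin 8) : tabOf (MulBit.ofPrime (gen k) (prime_gen k)) = To k :=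
  Prod.ext (ofPrime_gen_gI k) (funext fun j => ofPrime_gen_gen k j)

/-- `lin (To k) u = u (k+1)` and `lin (tabOf κ) u = u 0`: the coordinates themselves. [folklore] -/
theorem lin_To_κ (u : Fin 9 → ZMod 2) (k : Fin 8) : lin (To k) u = u k.succ ∧ lin (tabOf κ) u = u 0 := by
  obtain ⟨kI, kg⟩ := κ_table
  constructor
  · fin_cases k <;> simp [lin, To]
  · simp only [lin, tabOf, kI, kg, mul_one, mul_zero, add_zero]

/-- The tables of the named characters of the tree (files III–IV) and of `par3`, `chi3`, as
literals. [folklore] -/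
theorem tabOf_values :
    tabOf MulBit.qr5a = (1, ![0, 1, 0, 0, 1, 1, 1, 0]) ∧ tabOf MulBit.qr5b = (1, ![1, 1, 0, 0, 1, 1, 0, 1]) ∧
    tabOf MulBit.qr41a = (0, ![0, 1, 1, 1, 0, 0, 1, 1]) ∧ tabOf MulBit.qr41b = (0, ![0, 1, 1, 1, 0, 0, 1, 1]) ∧
    tabOf MulBit.qr73a = (0, ![1, 0, 0, 1, 1, 1, 0, 0]) ∧ tabOf MulBit.qr73b = (0, ![1, 0, 1, 0, 1, 1, 0, 0]) ∧
    tabOf MulBit.dyRe = (1, ![0, 0, 1, 1, 0, 0, 1, 1]) ∧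
    tabOf par3 = (0, ![0, 1, 0, 0, 0, 0, 0, 0]) ∧ tabOf chi3 = (0, ![1, 0, 1, 1, 1, 1, 0, 0]) := by
  obtain ⟨⟨p1, p2⟩, ⟨c1, c2⟩⟩ := par3_chi3_table
  exact ⟨Prod.ext qr5a_table.1 (funext qr5a_table.2), Prod.ext qr5b_table.1 (funext qr5b_table.2),
    Prod.ext qr41a_table.1 (funext qr41a_table.2), Prod.ext qr41b_table.1 (funext qr41b_table.2),
    Prod.ext qr73a_table.1 (funext qr73a_table.2), Prod.ext qr73b_table.1 (funext qr73b_table.2),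
    Prod.ext dyRe_table.1 (funext dyRe_table.2), Prod.ext p1 (funext p2), Prod.ext c1 (funext c2)⟩

/-! ### Even valuations outside `S` for a `K1`-point, and the `K1(S,2)` decompositions -/

/-- If `z w = D` in `ℤ[i]` and `v(D) = 1` then `v(z) = 1` (valuations are `≤ 1` on `ℤ[i]`). [folklore] -/
theorem valuation_eq_one_of_mul_eq_D {z w : ℤ[i]} (h : z * w = D) (v : HeightOneSpectrum ℤ[i])
    (hv : v.valuation K1 (toK1 D) = 1) : v.valuation K1 (toK1 z) = 1 := by
  rw [← h, map_mul, Valuation.map_mul] at hv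
  have hz : v.valuation K1 (toK1 z) ≤ 1 := by
    rw [← algebraMap_gaussianInt_K1]; exact v.valuation_le_one z
  have hw : v.valuation K1 (toK1 w) ≤ 1 := by
    rw [← algebraMap_gaussianInt_K1]; exact v.valuation_le_one w
  by_contra hne
  have hlt : v.valuation K1 (toK1 z) < 1 := lt_of_le_of_ne hz hne
  have : v.valuation K1 (toK1 z) * v.valuation K1 (toK1 w) < 1 :=
    calc v.valuation K1 (toK1 z) * v.valuation K1 (toK1 w) ≤ v.valuation K1 (toK1 z) * 1 := by gcongr
      _ < 1 := by rwa [mul_one]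
  exact absurd hv this.ne

/-- **Even valuations outside `S`.** For a `K1`-point `(x, y)`, `y ≠ 0`, of `E^{(2993)}` and a prime
`p ∤ D` of `ℤ[i]`: the `(p)`-adic valuations of `x` and `x + 2d` are even (Silverman AEC
Thm. X.1.1(c); tree `two_dvd_log_valuation_twoDescent`). [cite: SilvermanAEC2009, Thm. X.1.1(c)] -/
theorem two_dvd_log_valuation_point {x y : K1} (hy : y ≠ 0)
    (h : y ^ 2 = x * (x + 2 * 2993) * (x - 3 * 2993)) (p : ℤ[i]) (hp : Prime p) (hpD : ¬ p ∣ D) :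
    (2 : ℤ) ∣ log ((primeSpec p hp).valuation K1 x) ∧
      (2 : ℤ) ∣ log ((primeSpec p hp).valuation K1 (x + 2 * 2993)) := by
  have hE : y ^ 2 = (x - 0) * (x - (-2 * 2993)) * (x - 3 * 2993) := by rw [h]; ring
  have h₀ : x * (x + 2 * 2993) * (x - 3 * 2993) ≠ 0 := h ▸ pow_ne_zero 2 hy
  have hx : x ≠ 0 := fun h0 => h₀ (by rw [h0, zero_mul, zero_mul])
  have hx₂ : x ≠ -2 * 2993 := fun h0 => h₀ (by rw [h0]; ring)
  set S : Set (HeightOneSpectrum ℤ[i]) := {v | v.valuation K1 (toK1 D) < 1} with hSdef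
  have hS : ∀ v ∉ S,
      v.valuation K1 (0 : K1) ≤ 1 ∧ v.valuation K1 (-2 * 2993 : K1) ≤ 1 ∧ v.valuation K1 (3 * 2993 : K1) ≤ 1 ∧
      v.valuation K1 ((0 : K1) - (-2 * 2993)) = 1 ∧ v.valuation K1 ((0 : K1) - 3 * 2993) = 1 ∧
      v.valuation K1 ((-2 * 2993 : K1) - 3 * 2993) = 1 := by
    intro v hv
    have hv1 : v.valuation K1 (toK1 D) = 1 := by
      have hle : v.valuation K1 (toK1 D) ≤ 1 := by
        rw [← algebraMap_gaussianInt_K1]; exact v.valuation_le_one D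
      simp only [hSdef, Set.mem_setOf_eq, not_lt] at hv
      exact le_antisymm hle hv
    have i1 : (-2 * 2993 : K1) = toK1 ((-2 * 2993 : ℤ) : ℤ[i]) := by rw [toK1_intCast]; push_cast; ring
    have i2 : (3 * 2993 : K1) = toK1 ((3 * 2993 : ℤ) : ℤ[i]) := by rw [toK1_intCast]; push_cast; ring
    have i3 : (0 : K1) - (-2 * 2993) = toK1 ((5986 : ℤ) : ℤ[i]) := by rw [toK1_intCast]; push_cast; ring
    have i4 : (0 : K1) - 3 * 2993 = toK1 ((-8979 : ℤ) : ℤ[i]) := by rw [toK1_intCast]; push_cast; ring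
    have i5 : (-2 * 2993 : K1) - 3 * 2993 = toK1 ((-14965 : ℤ) : ℤ[i]) := by rw [toK1_intCast]; push_cast; ring
    refine ⟨by simp, ?_, ?_, ?_, ?_, ?_⟩
    · rw [i1, ← algebraMap_gaussianInt_K1]; exact v.valuation_le_one _
    · rw [i2, ← algebraMap_gaussianInt_K1]; exact v.valuation_le_one _
    · rw [i3]; exact valuation_eq_one_of_mul_eq_D (w := 15) (by rw [D]; decide) v hv1
    · rw [i4]; exact valuation_eq_one_of_mul_eq_D (w := -10) (by rw [D]; decide) v hv1
    · rw [i5]; exact valuation_eq_one_of_mul_eq_D (w := -6) (by rw [D]; decide) v hv1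
  have hvS : primeSpec p hp ∉ S := by
    simp only [hSdef, Set.mem_setOf_eq, not_lt]
    exact ((valuation_toK1_eq_one_iff hp).mpr hpD).ge
  have key := two_dvd_log_valuation_twoDescent (R := ℤ[i]) hS hE (primeSpec p hp) hvS
  refine ⟨?_, ?_⟩
  · have := key.1 hx; rwa [sub_zero] at this
  · have := key.2.1 hx₂; rwa [show x - -2 * 2993 = x + 2 * 2993 by ring] at this

/-- **The `K1(S,2)`-coordinates of a point.** For a `K1`-point `(x, y)`, `y ≠ 0`, of `E^{(2993)}`:
`x = toK1 (i^{a₁} ∏ (gen k)^{e₁ k}) t₁²` and `x + 2d = toK1 (i^{a₂} ∏ (gen k)^{e₂ k}) t₂²` with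
`aᵢ, eᵢ k ∈ {0, 1}`, `tᵢ ≠ 0` (`K1.exists_sq_decomposition`). [cite: SilvermanAEC2009, Thm. X.1.1(c)] -/
theorem exists_coords_point {x y : K1} (hy : y ≠ 0) (h : y ^ 2 = x * (x + 2 * 2993) * (x - 3 * 2993)) :
    ∃ (a₁ : ℕ) (e₁ : Fin 8 → ℕ) (t₁ : K1) (a₂ : ℕ) (e₂ : Fin 8 → ℕ) (t₂ : K1),
      t₁ ≠ 0 ∧ a₁ < 2 ∧ (∀ j, e₁ j < 2) ∧ x = toK1 (gI ^ a₁ * genProd e₁) * t₁ ^ 2 ∧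
      t₂ ≠ 0 ∧ a₂ < 2 ∧ (∀ j, e₂ j < 2) ∧ x + 2 * 2993 = toK1 (gI ^ a₂ * genProd e₂) * t₂ ^ 2 := by
  have h₀ : x * (x + 2 * 2993) * (x - 3 * 2993) ≠ 0 := h ▸ pow_ne_zero 2 hy
  have hx : x ≠ 0 := fun h0 => h₀ (by rw [h0, zero_mul, zero_mul])
  have hx₂ : x + 2 * 2993 ≠ 0 := fun h0 => h₀ (by rw [h0, mul_zero, zero_mul])
  obtain ⟨a₁, e₁, t₁, ht₁, ha₁, he₁, hx1⟩ := K1.exists_sq_decomposition hx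
    (fun p hp hpD => (two_dvd_log_valuation_point hy h p hp hpD).1)
  obtain ⟨a₂, e₂, t₂, ht₂, ha₂, he₂, hx2⟩ := K1.exists_sq_decomposition hx₂
    (fun p hp hpD => (two_dvd_log_valuation_point hy h p hp hpD).2)
  exact ⟨a₁, e₁, t₁, a₂, e₂, t₂, ht₁, ha₁, he₁, hx1, ht₂, ha₂, he₂, hx2⟩

/-! ### The thirteen linear local conditions -/

/-- The coordinate space `𝔽₂⁹ × 𝔽₂⁹` of `ψ`. [folklore] -/
abbrev V9 : Type := (Fin 9 → ZMod 2) × (Fin 9 → ZMod 2)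

/-- Literal tables of `qr5a, qr5b, qr41a (= qr41b), qr73a, qr73b, re, par3, chi3` (`tabOf_values`). [folklore] -/
def Tq5a : Tab := (1, ![0, 1, 0, 0, 1, 1, 1, 0])
/-- see `Tq5a`. [folklore] -/
def Tq5b : Tab := (1, ![1, 1, 0, 0, 1, 1, 0, 1])
/-- see `Tq5a`. [folklore] -/
def Tq41 : Tab := (0, ![0, 1, 1, 1, 0, 0, 1, 1])
/-- see `Tq5a`. [folklore] -/
def Tq73a : Tab := (0, ![1, 0, 0, 1, 1, 1, 0, 0])
/-- see `Tq5a`. [folklore] -/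
def Tq73b : Tab := (0, ![1, 0, 1, 0, 1, 1, 0, 0])
/-- see `Tq5a`. [folklore] -/
def Tre : Tab := (1, ![0, 0, 1, 1, 0, 0, 1, 1])
/-- see `Tq5a`. [folklore] -/
def Tp3 : Tab := (0, ![0, 1, 0, 0, 0, 0, 0, 0])
/-- see `Tq5a`. [folklore] -/
def Tc3 : Tab := (0, ![1, 0, 1, 1, 1, 1, 0, 0])

/-- **The thirteen local conditions as linear forms** on `(u, u') =` (coordinates of `x`,
coordinates of `x + 2d`): at `2+i`: `ord(x) ≡ 0`, `qr(x) = 0`; at `2-i`: the same; at `5+4i`: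
`qr(x) = ord(x+2d)`; at `5-4i`: `qr(x) = ord(x+2d)`, `qr(x+2d) = 0`; at `8+3i`: `qr(x) = 0`,
`qr(x+2d) = ord(x)`; at `8-3i`: `qr(x+2d) = ord(x)`; at `(3)`: `ord(x+2d) ≡ 0`, `χ₃(x+2d) = 0`;
at `1+i`: `ord(x) + re(x) + re(x+2d) = 0`. [folklore] -/
def Lfun (v : V9) : Fin 13 → ZMod 2 :=
  ![lin (To 2) v.1, lin Tq5a v.1, lin (To 3) v.1, lin Tq5b v.1, lin Tq41 v.1 + lin (To 4) v.2,
    lin Tq41 v.1 + lin (To 5) v.2, lin Tq41 v.2, lin Tq73a v.1, lin Tq73a v.2 + lin (To 6) v.1,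
    lin Tq73b v.2 + lin (To 7) v.1, lin Tp3 v.2, lin Tc3 v.2, lin (To 0) v.1 + lin Tre v.1 + lin Tre v.2]

/-- `Lfun` is additive. [folklore] -/
theorem Lfun_add (v w : V9) : Lfun (v + w) = Lfun v + Lfun w := by
  ext k
  fin_cases k <;> simp [Lfun, lin_add] <;> ring

/-- **The local conditions as a homomorphism** `L : 𝔽₂⁹ × 𝔽₂⁹ → 𝔽₂¹³`. [folklore] -/
def L : V9 →+ (Fin 13 → ZMod 2) where
  toFun := Lfun
  map_zero' := by
    have h := Lfun_add 0 0
    rw [add_zero] at h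
    exact left_eq_add.mp h
  map_add' := Lfun_add

/-- `L v = Lfun v`. [folklore] -/
theorem L_apply (v : V9) : L v = Lfun v := rfl

/-- Arithmetic of the constants for `d = 2993`: `2993 ≡ 3 (mod 5)` is a non-square; the cofactors
`(5∓4i)·73`, `(8∓3i)·41` are squares modulo `5±4i`, `8±3i`. [folklore] -/
theorem constants_2993 :
    qrBitZMod 5 (red5a 𝕕) = 1 ∧ qrBitZMod 5 (red5b 𝕕) = 1 ∧
    ((𝕕 : ℤ[i]) = g41a * (g41b * 73) ∧ ¬ g41a ∣ g41b * 73 ∧ qrBitZMod 41 (red41a (g41b * 73)) = 0) ∧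
    ((𝕕 : ℤ[i]) = g41b * (g41a * 73) ∧ ¬ g41b ∣ g41a * 73 ∧ qrBitZMod 41 (red41b (g41a * 73)) = 0) ∧
    ((𝕕 : ℤ[i]) = g73a * (g73b * 41) ∧ ¬ g73a ∣ g73b * 41 ∧ qrBitZMod 73 (red73a (g73b * 41)) = 0) ∧
    ((𝕕 : ℤ[i]) = g73b * (g73a * 41) ∧ ¬ g73b ∣ g73a * 41 ∧ qrBitZMod 73 (red73b (g73a * 41)) = 0) := by
  refine ⟨?_, ?_, ⟨by decide, not_dvd_of_apply_ne_zero red41a_eq_zero_iff (by decide), ?_⟩,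
    ⟨by decide, not_dvd_of_apply_ne_zero red41b_eq_zero_iff (by decide), ?_⟩,
    ⟨by decide, not_dvd_of_apply_ne_zero red73a_eq_zero_iff (by decide), ?_⟩,
    ⟨by decide, not_dvd_of_apply_ne_zero red73b_eq_zero_iff (by decide), ?_⟩⟩
  · exact (qrBitZMod_eq_one_iff _).mpr (not_isSquare_of_forall_ne _ (by decide))
  · exact (qrBitZMod_eq_one_iff _).mpr (not_isSquare_of_forall_ne _ (by decide))
  · exact (qrBitZMod_eq_zero_iff _).mpr ⟨19, by decide⟩
  · exact (qrBitZMod_eq_zero_iff _).mpr ⟨19, by decide⟩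
  · exact (qrBitZMod_eq_zero_iff _).mpr ⟨27, by decide⟩
  · exact (qrBitZMod_eq_zero_iff _).mpr ⟨27, by decide⟩

/-- **Every `K1`-point with `y ≠ 0` satisfies the thirteen conditions**: `L (u, u') = 0` for the
coordinates `(u, u')` of `(x, x + 2d)` — from the tree's local lemmas at `2±i`, `5±4i`, `8±3i`,
`1+i` (`five_a/b_conditions`, `fortyone_a/b_conditions`, `seventythree_a/b_conditions`,
`local_dyadic`) and `three_conditions`. [cite: SilvermanAEC2009, Prop. X.1.4] -/
theorem L_coords_point {x y : K1} (hy : y ≠ 0) (h : y ^ 2 = x * (x + 2 * 2993) * (x - 3 * 2993))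
    {a₁ : ℕ} {e₁ : Fin 8 → ℕ} {t₁ : K1} {a₂ : ℕ} {e₂ : Fin 8 → ℕ} {t₂ : K1} (ht₁ : t₁ ≠ 0) (ht₂ : t₂ ≠ 0)
    (hx1 : x = toK1 (gI ^ a₁ * genProd e₁) * t₁ ^ 2) (hx2 : x + 2 * 2993 = toK1 (gI ^ a₂ * genProd e₂) * t₂ ^ 2) :
    L (coords a₁ e₁, coords a₂ e₂) = 0 := by
  have h₀ : x * (x + 2 * 2993) * (x - 3 * 2993) ≠ 0 := h ▸ pow_ne_zero 2 hy
  have hx : x ≠ 0 := fun h0 => h₀ (by rw [h0, zero_mul, zero_mul])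
  have hx₂ : x + 2 * 2993 ≠ 0 := fun h0 => h₀ (by rw [h0, mul_zero, zero_mul])
  obtain ⟨z, n, w, m, hn, hm, hw, hxz, hx2z, heq⟩ := exists_encoding hy h
  obtain ⟨hz, hZ2, hZ3⟩ := factors_ne_zero_of_eq hn hw heq
  -- character values: encoding side and coordinate side
  have enc := fun χ : MulBit => onK1_encoding χ hn hz hZ2 hxz hx2z
  have crd₁ : ∀ χ : MulBit, χ.onK1 x = lin (tabOf χ) (coords a₁ e₁) := fun χ => by
    rw [hx1]; exact onK1_eq_lin χ a₁ e₁ ht₁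
  have crd₂ : ∀ χ : MulBit, χ.onK1 (x + 2 * 2993) = lin (tabOf χ) (coords a₂ e₂) := fun χ => by
    rw [hx2]; exact onK1_eq_lin χ a₂ e₂ ht₂
  obtain ⟨T5a, T5b, T41a, T41b, T73a, T73b, Tr, TP3, TC3⟩ := tabOf_values
  obtain ⟨c5a, c5b, ⟨d41a, n41a, s41a⟩, ⟨d41b, n41b, s41b⟩, ⟨d73a, n73a, s73a⟩, ⟨d73b, n73b, s73b⟩⟩ :=
    constants_2993
  -- the local lemmas
  have h5a := five_a_conditions (d := 𝕕) (not_dvd_of_apply_ne_zero red5a_eq_zero_iff (by decide)) hn hm hw heq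
  have h5b := five_b_conditions (d := 𝕕) (not_dvd_of_apply_ne_zero red5b_eq_zero_iff (by decide)) hn hm hw heq
  have h41a := fortyone_a_conditions d41a n41a s41a hn hm hw heq
  have h41b := fortyone_b_conditions d41b n41b s41b hn hm hw heq
  have h73a := seventythree_a_conditions d73a n73a s73a hn hm hw heq
  have h73b := seventythree_b_conditions d73b n73b s73b hn hm hw heq
  have hdy := (local_dyadic (d := 𝕕) (by decide) hn hm hw heq).2.1
  have h3 := three_conditions hy h
  rw [c5a] at h5a
  rw [c5b] at h5b
  -- translate each into the coordinates
  have two : (1 : ZMod 2) + 1 = 0 := by decide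
  have E : ∀ χ : MulBit, χ z + χ n = lin (tabOf χ) (coords a₁ e₁) ∧
      χ (z + 2 * 𝕕 * n) + χ n = lin (tabOf χ) (coords a₂ e₂) := fun χ =>
    ⟨((enc χ).1).symm.trans (crd₁ χ), ((enc χ).2).symm.trans (crd₂ χ)⟩
  have o2 := E (MulBit.ofPrime (gen 2) (prime_gen 2)); rw [tabOf_ofPrime] at o2
  have o3 := E (MulBit.ofPrime (gen 3) (prime_gen 3)); rw [tabOf_ofPrime] at o3
  have o4 := E (MulBit.ofPrime (gen 4) (prime_gen 4)); rw [tabOf_ofPrime] at o4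
  have o5 := E (MulBit.ofPrime (gen 5) (prime_gen 5)); rw [tabOf_ofPrime] at o5
  have o6 := E (MulBit.ofPrime (gen 6) (prime_gen 6)); rw [tabOf_ofPrime] at o6
  have o7 := E (MulBit.ofPrime (gen 7) (prime_gen 7)); rw [tabOf_ofPrime] at o7
  have o0 := E (MulBit.ofPrime (gen 0) (prime_gen 0)); rw [tabOf_ofPrime] at o0
  have q5a := E MulBit.qr5a; rw [T5a] at q5a
  have q5b := E MulBit.qr5b; rw [T5b] at q5b
  have q41a := E MulBit.qr41a; rw [T41a] at q41a
  have q41b := E MulBit.qr41b; rw [T41b] at q41b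
  have q73a := E MulBit.qr73a; rw [T73a] at q73a
  have q73b := E MulBit.qr73b; rw [T73b] at q73b
  have re := E MulBit.dyRe; rw [Tr] at re
  -- the place `(3)`: through `par3`, `chi3`
  obtain ⟨p3x, c3x⟩ := par3_chi3_onK1 hx₂
  have p3 : lin Tp3 (coords a₂ e₂) = 0 := by
    have t := crd₂ par3
    rw [TP3, p3x] at t
    show lin (0, ![0, 1, 0, 0, 0, 0, 0, 0]) (coords a₂ e₂) = 0
    rw [← t]; exact (𝔴.parity_eq_zero_iff _).mpr h3.1
  have c3 : lin Tc3 (coords a₂ e₂) = 0 := by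
    have t := crd₂ chi3
    rw [TC3, c3x] at t
    show lin (0, ![1, 0, 1, 1, 1, 1, 0, 0]) (coords a₂ e₂) = 0
    rw [← t]; exact h3.2
  -- assemble
  change MulBit.ofPrime (gen 2) (prime_gen 2) z + MulBit.ofPrime (gen 2) (prime_gen 2) n = 0 ∧
    MulBit.qr5a z + MulBit.qr5a n = (MulBit.ofPrime (gen 2) (prime_gen 2) (z + 2 * 𝕕 * n) +
      MulBit.ofPrime (gen 2) (prime_gen 2) n) * (1 + 1) at h5a
  change MulBit.ofPrime (gen 3) (prime_gen 3) z + MulBit.ofPrime (gen 3) (prime_gen 3) n = 0 ∧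
    MulBit.qr5b z + MulBit.qr5b n = (MulBit.ofPrime (gen 3) (prime_gen 3) (z + 2 * 𝕕 * n) +
      MulBit.ofPrime (gen 3) (prime_gen 3) n) * (1 + 1) at h5b
  change MulBit.qr41a z + MulBit.qr41a n = MulBit.ofPrime (gen 4) (prime_gen 4) (z + 2 * 𝕕 * n) +
      MulBit.ofPrime (gen 4) (prime_gen 4) n ∧ MulBit.qr41a (z + 2 * 𝕕 * n) + MulBit.qr41a n = 0 at h41a
  change MulBit.qr41b z + MulBit.qr41b n = MulBit.ofPrime (gen 5) (prime_gen 5) (z + 2 * 𝕕 * n) +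
      MulBit.ofPrime (gen 5) (prime_gen 5) n ∧ MulBit.qr41b (z + 2 * 𝕕 * n) + MulBit.qr41b n = 0 at h41b
  change MulBit.qr73a z + MulBit.qr73a n = 0 ∧ MulBit.qr73a (z + 2 * 𝕕 * n) + MulBit.qr73a n =
      MulBit.ofPrime (gen 6) (prime_gen 6) z + MulBit.ofPrime (gen 6) (prime_gen 6) n at h73a
  change MulBit.qr73b z + MulBit.qr73b n = 0 ∧ MulBit.qr73b (z + 2 * 𝕕 * n) + MulBit.qr73b n =
      MulBit.ofPrime (gen 7) (prime_gen 7) z + MulBit.ofPrime (gen 7) (prime_gen 7) n at h73b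
  change MulBit.ofPrime (gen 0) (prime_gen 0) z + MulBit.ofPrime (gen 0) (prime_gen 0) n + MulBit.dyRe z +
      MulBit.dyRe (z + 2 * 𝕕 * n) = 0 at hdy
  rw [two, mul_zero] at h5a h5b
  have hdy' : (MulBit.ofPrime (gen 0) (prime_gen 0) z + MulBit.ofPrime (gen 0) (prime_gen 0) n) +
      (MulBit.dyRe z + MulBit.dyRe n) + (MulBit.dyRe (z + 2 * 𝕕 * n) + MulBit.dyRe n) = 0 := by
    have : MulBit.dyRe n + MulBit.dyRe n = 0 := CharTwo.add_self_eq_zero _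
    linear_combination hdy + this
  rw [o2.1] at h5a
  rw [o3.1] at h5b
  rw [q5a.1] at h5a
  rw [q5b.1] at h5b
  rw [q41a.1, q41a.2, o4.2] at h41a
  rw [q41b.1, q41b.2, o5.2] at h41b
  rw [q73a.1, q73a.2, o6.1] at h73a
  rw [q73b.1, q73b.2, o7.1] at h73b
  rw [o0.1, re.1, re.2] at hdy'
  have eqz : ∀ a b : ZMod 2, a = b → a + b = 0 := by decide
  rw [L_apply]
  ext k
  fin_cases k
  · exact h5a.1
  · exact h5a.2
  · exact h5b.1
  · exact h5b.2
  · exact eqz _ _ h41a.1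
  · exact eqz _ _ h41b.1
  · exact h41b.2
  · exact h73a.1
  · exact eqz _ _ h73a.2
  · exact eqz _ _ h73b.2
  · exact p3
  · exact c3
  · exact hdy'

/-! ### Counting: `#TK ≤ 32` by a rank certificate -/

/-- An explicit `𝔽₂`-linear map `R : 𝔽₂¹³ → 𝔽₂¹³` (row operations bringing `L` to reduced form on its
pivot columns). [folklore] -/
def Rfun (w : Fin 13 → ZMod 2) : Fin 13 → ZMod 2 :=
  ![w 0 + w 3 + w 5 + w 6 + w 7 + w 8 + w 10 + w 11,
    w 1 + w 3 + w 6 + w 8 + w 9 + w 10,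
    w 0 + w 2 + w 5 + w 6 + w 8 + w 9 + w 10,
    w 0,
    w 2,
    w 1 + w 2 + w 3 + w 6 + w 7 + w 8 + w 9 + w 10,
    w 6 + w 8 + w 10 + w 11,
    w 9 + w 11,
    w 1 + w 2 + w 5 + w 7 + w 8 + w 11 + w 12,
    w 4 + w 5 + w 6 + w 10 + w 11,
    w 10,
    w 6 + w 10,
    w 4 + w 5]

/-- `Rfun` is additive. [folklore] -/
theorem Rfun_add (v w : Fin 13 → ZMod 2) : Rfun (v + w) = Rfun v + Rfun w := by
  ext k
  fin_cases k <;> simp [Rfun] <;> ring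

/-- `R` as a homomorphism. [folklore] -/
def R : (Fin 13 → ZMod 2) →+ (Fin 13 → ZMod 2) where
  toFun := Rfun
  map_zero' := by
    have h := Rfun_add 0 0
    rw [add_zero] at h
    exact left_eq_add.mp h
  map_add' := Rfun_add

set_option maxRecDepth 100000 in
/-- Thirteen vectors (unit vectors at the pivot columns of `L`). [folklore] -/
def W : Fin 13 → V9 :=
  ![(![1, 0, 0, 0, 0, 0, 0, 0, 0], ![0, 0, 0, 0, 0, 0, 0, 0, 0]),
    (![0, 1, 0, 0, 0, 0, 0, 0, 0], ![0, 0, 0, 0, 0, 0, 0, 0, 0]),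
    (![0, 0, 1, 0, 0, 0, 0, 0, 0], ![0, 0, 0, 0, 0, 0, 0, 0, 0]),
    (![0, 0, 0, 1, 0, 0, 0, 0, 0], ![0, 0, 0, 0, 0, 0, 0, 0, 0]),
    (![0, 0, 0, 0, 1, 0, 0, 0, 0], ![0, 0, 0, 0, 0, 0, 0, 0, 0]),
    (![0, 0, 0, 0, 0, 1, 0, 0, 0], ![0, 0, 0, 0, 0, 0, 0, 0, 0]),
    (![0, 0, 0, 0, 0, 0, 0, 1, 0], ![0, 0, 0, 0, 0, 0, 0, 0, 0]),
    (![0, 0, 0, 0, 0, 0, 0, 0, 1], ![0, 0, 0, 0, 0, 0, 0, 0, 0]),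
    (![0, 0, 0, 0, 0, 0, 0, 0, 0], ![1, 0, 0, 0, 0, 0, 0, 0, 0]),
    (![0, 0, 0, 0, 0, 0, 0, 0, 0], ![0, 1, 0, 0, 0, 0, 0, 0, 0]),
    (![0, 0, 0, 0, 0, 0, 0, 0, 0], ![0, 0, 1, 0, 0, 0, 0, 0, 0]),
    (![0, 0, 0, 0, 0, 0, 0, 0, 0], ![0, 0, 0, 1, 0, 0, 0, 0, 0]),
    (![0, 0, 0, 0, 0, 0, 0, 0, 0], ![0, 0, 0, 0, 0, 1, 0, 0, 0])]

set_option maxRecDepth 100000 in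
/-- **The rank certificate**: `R (L (W k)) = δ_k`, so `R ∘ L : 𝔽₂¹⁸ → 𝔽₂¹³` is onto and `L` has rank
`13`. [folklore] -/
theorem certificate : ∀ k : Fin 13, R (L (W k)) = Pi.single k 1 := by
  decide

/-- `R ∘ L` is surjective. [folklore] -/
theorem surjective_RL : Function.Surjective (R.comp L) := by
  intro u
  refine ⟨∑ k, (if u k = 1 then W k else 0), ?_⟩
  rw [map_sum]
  have : ∀ k, (R.comp L) (if u k = 1 then W k else 0) = if u k = 1 then Pi.single k 1 else 0 := by
    intro k
    split_ifs
    · exact certificate k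
    · exact (R.comp L).map_zero
  simp only [this]
  ext j
  rw [Finset.sum_apply, Finset.sum_eq_single j]
  · by_cases hj : u j = 1
    · rw [if_pos hj, Pi.single_eq_same, hj]
    · rw [if_neg hj, Pi.zero_apply]
      revert hj; generalize u j = b; revert b; decide
  · intro k _ hkj
    split_ifs
    · exact Pi.single_eq_of_ne' hkj _
    · rfl
  · intro h; exact absurd (Finset.mem_univ j) h

/-- `#(𝔽₂⁹ × 𝔽₂⁹) = 2¹⁸`, `#𝔽₂¹³ = 2¹³`. [folklore] -/
theorem card_V9 : Nat.card V9 = 2 ^ 18 ∧ Nat.card (Fin 13 → ZMod 2) = 2 ^ 13 := by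
  constructor <;> simp [Nat.card_eq_fintype_card, Fintype.card_prod, Fintype.card_pi, ZMod.card]

/-- **The target set**: the kernel of the thirteen conditions. [folklore] -/
def TK : Finset V9 := Finset.univ.filter fun v => L v = 0

set_option maxRecDepth 100000 in
/-- **`#TK ≤ 32 = 2¹⁸/2¹³`**: `TK ⊆ ker (R ∘ L)`, a subgroup of index `2¹³` (`R ∘ L` is onto).
[folklore] -/
theorem card_TK_le : TK.card ≤ 32 := by
  set f : V9 →+ (Fin 13 → ZMod 2) := R.comp L with hf
  -- `#ker f = 32`
  have hquot : Nat.card (V9 ⧸ f.ker) = 2 ^ 13 := by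
    rw [Nat.card_congr (QuotientAddGroup.quotientKerEquivOfSurjective f surjective_RL).toEquiv]
    exact card_V9.2
  have hlag := AddSubgroup.card_eq_card_quotient_mul_card_addSubgroup f.ker
  rw [card_V9.1, hquot] at hlag
  have hker : Nat.card f.ker = 32 := by
    have : (2 : ℕ) ^ 18 = 2 ^ 13 * 32 := by norm_num
    rw [this] at hlag
    exact (Nat.eq_of_mul_eq_mul_left (by norm_num) hlag).symm
  -- `TK ⊆ {v | f v = 0}`
  have hsub : TK ⊆ Finset.univ.filter fun v => f v = 0 := by
    intro v hv
    simp only [TK, Finset.mem_filter, Finset.mem_univ, true_and] at hv ⊢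
    rw [hf, AddMonoidHom.comp_apply, hv, _root_.map_zero]
  have hcard : (Finset.univ.filter fun v : V9 => f v = 0).card = Nat.card f.ker := by
    rw [← Fintype.card_subtype, ← Nat.card_eq_fintype_card]
    exact Nat.card_congr (Equiv.subtypeEquivRight fun v => (AddMonoidHom.mem_ker).symm)
  calc TK.card ≤ (Finset.univ.filter fun v : V9 => f v = 0).card := Finset.card_le_card hsub
    _ = 32 := by rw [hcard, hker]

/-! ### The coordinates character `ψ : E^{(2993)}(K1) → 𝔽₂⁹ × 𝔽₂⁹` -/

/-- The nine coordinate characters `κ, ord_{1+i}, ord_3, ord_{2±i}, ord_{5±4i}, ord_{8±3i}`. [folklore] -/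
def cχ : Fin 9 → MulBit := Fin.cons κ fun k => MulBit.ofPrime (gen k) (prime_gen k)

/-- **The coordinate characters read off the coordinates**: on
`x = toK1 (i^a ∏ (gen k)^(e k)) t²`, `(χⱼ(x))ⱼ = (a; e₀, …, e₇)`. [folklore] -/
theorem cχ_coords (a : ℕ) (e : Fin 8 → ℕ) {t : K1} (ht : t ≠ 0) :
    (fun j => (cχ j).onK1 (toK1 (gI ^ a * genProd e) * t ^ 2)) = coords a e := by
  funext j
  rw [onK1_eq_lin _ a e ht]
  refine Fin.cases ?_ (fun k => ?_) j
  · rw [show cχ 0 = κ from rfl, (lin_To_κ _ 0).2]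
  · rw [show cχ k.succ = MulBit.ofPrime (gen k) (prime_gen k) from rfl, tabOf_ofPrime, (lin_To_κ _ k).1]

/-- The square-class characters as one homomorphism `K1ˣ/K1ˣ² → 𝔽₂⁹`. [folklore] -/
def vecHom : Additive (SqUnits K1) →+ (Fin 9 → ZMod 2) := AddMonoidHom.pi fun j => (cχ j).hom

/-- `vecHom` on the class of a decomposed element. [folklore] -/
theorem vecHom_sqClass (a : ℕ) (e : Fin 8 → ℕ) {t : K1} (ht : t ≠ 0) :
    vecHom (Additive.ofMul (sqClass (toK1 (gI ^ a * genProd e) * t ^ 2))) = coords a e := by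
  have hG : gI ^ a * genProd e ≠ 0 := mul_ne_zero (pow_ne_zero a (by decide)) (genProd_ne_zero e)
  have hb : toK1 (gI ^ a * genProd e) * t ^ 2 ≠ 0 := mul_ne_zero (toK1_ne_zero hG) (pow_ne_zero 2 ht)
  rw [← cχ_coords a e ht]
  funext j
  rw [vecHom, AddMonoidHom.pi_apply, (cχ j).hom_sqClass hb]

/-- **The coordinates character** `ψ = (coordinates of δ₁, coordinates of δ₂)`,
`δ = (x, x + 2d)` the complete `2`-descent map. [folklore] -/
def ψ : (E').toAffine.Point →+ V9 :=
  (vecHom.comp ((MonoidHom.toAdditive (MonoidHom.fst (SqUnits K1) (SqUnits K1))).comp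
    (twoDescentMap splitTwoTorsion_E'))).prod
  (vecHom.comp ((MonoidHom.toAdditive (MonoidHom.snd (SqUnits K1) (SqUnits K1))).comp
    (twoDescentMap splitTwoTorsion_E')))

/-- `ψ` in terms of the two descent components. [folklore] -/
theorem ψ_apply (P : (E').toAffine.Point) :
    ψ P = (vecHom (Additive.ofMul (twoDescentComponent (E').toAffine 0 (-2 * 2993) (3 * 2993) P)),
      vecHom (Additive.ofMul (twoDescentComponent (E').toAffine (-2 * 2993) 0 (3 * 2993) P))) := by
  simp [ψ, twoDescentMap_apply]

/-- `ψ` on a point with `x ≠ 0, -2d`, in coordinates. [folklore] -/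
theorem ψ_some {x y : K1} (hP : (E').toAffine.Nonsingular x y) (hx₁ : x ≠ 0) (hx₂ : x ≠ -2 * 2993)
    {a₁ : ℕ} {e₁ : Fin 8 → ℕ} {t₁ : K1} {a₂ : ℕ} {e₂ : Fin 8 → ℕ} {t₂ : K1} (ht₁ : t₁ ≠ 0) (ht₂ : t₂ ≠ 0)
    (hx1 : x = toK1 (gI ^ a₁ * genProd e₁) * t₁ ^ 2) (hx2 : x + 2 * 2993 = toK1 (gI ^ a₂ * genProd e₂) * t₂ ^ 2) :
    ψ (.some _ _ hP) = (coords a₁ e₁, coords a₂ e₂) := by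
  rw [ψ_apply, twoDescentComponent_some_of_ne hP hx₁, twoDescentComponent_some_of_ne hP hx₂, sub_zero,
    show x - -2 * 2993 = x + 2 * 2993 by ring, hx1, vecHom_sqClass a₁ e₁ ht₁, ← hx1, hx2,
    vecHom_sqClass a₂ e₂ ht₂]

/-! ### The `2`-torsion -/

/-- `genProd` on the exponent vectors met. [folklore] -/
theorem genProd_values : genProd ![0, 1, 0, 0, 0, 0, 0, 0] = 3 ∧
    genProd ![0, 0, 0, 0, 1, 1, 1, 1] = g41a * g41b * g73a * g73b ∧ genProd ![0, 0, 1, 1, 0, 0, 0, 0] = g5a * g5b ∧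
    genProd ![0, 1, 0, 0, 1, 1, 1, 1] = 3 * g41a * g41b * g73a * g73b ∧
    genProd ![0, 0, 1, 1, 1, 1, 1, 1] = g5a * g5b * g41a * g41b * g73a * g73b := by
  obtain ⟨h0, h1, h2, h3, h4, h5, h6, h7⟩ := gen_apply
  simp only [genProd, Fin.prod_univ_eight, h0, h1, h2, h3, h4, h5, h6, h7]
  simp

/-- The descent values at the `2`-torsion as decompositions: `(0 - (-2d))(0 - 3d) = i·3·((1+i)·2993)²`,
`0 - (-2d) = i·(41·73)·(1-i)²`, `-2d - 0 = i·(41·73)·(1+i)²`, `(-2d - 0)(-2d - 3d) = i·5·((1-i)·2993)²`,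
`3d - 0 = 3·41·73`, `3d - (-2d) = 5·41·73`. [folklore] -/
theorem torsion_values :
    ((0 : K1) - (-2 * 2993)) * (0 - 3 * 2993) =
      toK1 (gI ^ 1 * genProd ![0, 1, 0, 0, 0, 0, 0, 0]) * (toK1 (g2 * 2993)) ^ 2 ∧
    (0 : K1) - (-2 * 2993) = toK1 (gI ^ 1 * genProd ![0, 0, 0, 0, 1, 1, 1, 1]) * (toK1 ⟨1, -1⟩) ^ 2 ∧
    (-2 * 2993 : K1) - 0 = toK1 (gI ^ 1 * genProd ![0, 0, 0, 0, 1, 1, 1, 1]) * (toK1 g2) ^ 2 ∧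
    ((-2 * 2993 : K1) - 0) * (-2 * 2993 - 3 * 2993) =
      toK1 (gI ^ 1 * genProd ![0, 0, 1, 1, 0, 0, 0, 0]) * (toK1 (⟨1, -1⟩ * 2993)) ^ 2 ∧
    (3 * 2993 : K1) - 0 = toK1 (gI ^ 0 * genProd ![0, 1, 0, 0, 1, 1, 1, 1]) * (toK1 1) ^ 2 ∧
    (3 * 2993 : K1) - (-2 * 2993) = toK1 (gI ^ 0 * genProd ![0, 0, 1, 1, 1, 1, 1, 1]) * (toK1 1) ^ 2 := by
  obtain ⟨p1, p2, p3, p4, p5⟩ := genProd_values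
  rw [p1, p2, p3, p4, p5]
  have e : ∀ z : ℤ[i], ∀ q : ℤ, (q : ℤ[i]) = z → (q : K1) = toK1 z := fun z q h => by
    rw [← h, toK1_intCast]
  refine ⟨?_, ?_, ?_, ?_, ?_, ?_⟩
  · rw [← map_pow, ← map_mul, ← e _ (5986 * -8979) (by decide)]; push_cast; ring
  · rw [← map_pow, ← map_mul, ← e _ 5986 (by decide)]; push_cast; ring
  · rw [← map_pow, ← map_mul, ← e _ (-5986) (by decide)]; push_cast; ring
  · rw [← map_pow, ← map_mul, ← e _ (-5986 * -14965) (by decide)]; push_cast; ring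
  · rw [← map_pow, ← map_mul, ← e _ 8979 (by decide)]; push_cast; ring
  · rw [← map_pow, ← map_mul, ← e _ 14965 (by decide)]; push_cast; ring

/-- `ψ` at the points with `x = 0` (`T₁`). [folklore] -/
theorem ψ_x0 {y : K1} (hP : (E').toAffine.Nonsingular 0 y) :
    ψ (.some _ _ hP) = (coords 1 ![0, 1, 0, 0, 0, 0, 0, 0], coords 1 ![0, 0, 0, 0, 1, 1, 1, 1]) := by
  obtain ⟨c1, c2, -, -, -, -⟩ := torsion_values
  rw [ψ_apply, twoDescentComponent_some_of_eq hP rfl, twoDescentComponent_some_of_ne hP (by norm_num), c1, c2,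
    vecHom_sqClass _ _ (toK1_ne_zero (by decide)), vecHom_sqClass _ _ (toK1_ne_zero (by decide))]

/-- `ψ` at the points with `x = -2d` (`T₂`). [folklore] -/
theorem ψ_x2 {y : K1} (hP : (E').toAffine.Nonsingular (-2 * 2993) y) :
    ψ (.some _ _ hP) = (coords 1 ![0, 0, 0, 0, 1, 1, 1, 1], coords 1 ![0, 0, 1, 1, 0, 0, 0, 0]) := by
  obtain ⟨-, -, c3, c4, -, -⟩ := torsion_values
  rw [ψ_apply, twoDescentComponent_some_of_ne hP (by norm_num), twoDescentComponent_some_of_eq hP rfl, c4, c3,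
    vecHom_sqClass _ _ (toK1_ne_zero (by decide)), vecHom_sqClass _ _ (toK1_ne_zero (by decide))]

/-- `ψ` at the points with `x = 3d` (`T₃`). [folklore] -/
theorem ψ_x3 {y : K1} (hP : (E').toAffine.Nonsingular (3 * 2993) y) :
    ψ (.some _ _ hP) = (coords 0 ![0, 1, 0, 0, 1, 1, 1, 1], coords 0 ![0, 0, 1, 1, 1, 1, 1, 1]) := by
  obtain ⟨-, -, -, -, c5, c6⟩ := torsion_values
  rw [ψ_apply, twoDescentComponent_some_of_ne hP (by norm_num), twoDescentComponent_some_of_ne hP (by norm_num),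
    c5, c6, vecHom_sqClass _ _ (toK1_ne_zero one_ne_zero), vecHom_sqClass _ _ (toK1_ne_zero one_ne_zero)]

/-! ### The main theorem -/

/-- Coordinates vanish only for the trivial decomposition. [folklore] -/
theorem eq_zero_of_coords_eq_zero {a : ℕ} {e : Fin 8 → ℕ} (ha : a < 2) (he : ∀ j, e j < 2)
    (h : coords a e = 0) : a = 0 ∧ e = 0 := by
  have h0 : ((a : ℕ) : ZMod 2) = 0 := by have := congrFun h 0; simpa [coords] using this
  have hj : ∀ k : Fin 8, ((e k : ℕ) : ZMod 2) = 0 := fun k => by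
    have := congrFun h k.succ; simpa [coords] using this
  refine ⟨?_, funext fun k => ?_⟩
  · obtain ⟨m, hm⟩ := (ZMod.natCast_eq_zero_iff_even).mp h0; omega
  · obtain ⟨m, hm⟩ := (ZMod.natCast_eq_zero_iff_even).mp (hj k); have := he k
    show e k = 0; omega

set_option maxHeartbeats 2000000 in
set_option maxRecDepth 100000 in
/-- **`rk E^{(2993)}(ℚ(√-1)) ≤ 3`** — the upper bound `hU2993` of `descent_480a1_F4_of_upper_bounds`,
by a complete `2`-descent over `K1 = ℚ(√-1)` (`h = 1`, units `±1, ±i`): `ψ` has image in `TK`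
(`L_coords_point` off the `2`-torsion, direct evaluation on it), `#TK ≤ 32` (`card_TK_le`), and
kernel in `2E(K1)` (trivial coordinates mean `x` and `x + 2d` are squares, `ker δ = 2E`); counting by
`mordellWeilRank_le_of_range_subset` with `r = 3`. Dokchitser–Dokchitser: "2-descent shows that …
`rk E/F₄ = 6` (… over all minimal non-trivial subfields)"; on `ℚ(√-1)`,
`rk E^{(2993)} = rk E^{(2993)}(ℚ) + rk E^{(-2993)}(ℚ) = 1 + 2`.
[cite: DokchitserDokchitser2011RankModN, proof of Thm. 2] -/
theorem mordellWeilRank_le_three : (E').mordellWeilRank ≤ 3 := by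
  have h := splitTwoTorsion_E'
  set T₁ : (E').toAffine.Point := .some _ _ (nonsingular_twoTorsion h) with hT₁
  set T₂ : (E').toAffine.Point := .some _ _ (nonsingular_twoTorsion h.swap₁₂) with hT₂
  -- image in `TK`
  have hsub : ∀ P, ψ P ∈ TK := by
    intro P
    rw [TK, Finset.mem_filter]
    refine ⟨Finset.mem_univ _, ?_⟩
    rcases P with _ | ⟨x, y, hP⟩
    · show L (ψ 0) = 0
      rw [ψ.map_zero, L.map_zero]
    · by_cases hx₁ : x = 0
      · subst hx₁; rw [ψ_x0 hP]; decide
      by_cases hx₂ : x = -2 * 2993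
      · subst hx₂; rw [ψ_x2 hP]; decide
      by_cases hy : y = 0
      · subst hy
        rcases x_eq_of_y_eq_zero hP with h0 | h2 | h3
        · exact absurd h0 hx₁
        · exact absurd h2 hx₂
        · subst h3; rw [ψ_x3 hP]; decide
      · have hE := (nonsingular_iff_E' x y).mp hP
        obtain ⟨a₁, e₁, t₁, a₂, e₂, t₂, ht₁, -, -, hx1, ht₂, -, -, hx2⟩ := exists_coords_point hy hE
        rw [ψ_some hP hx₁ hx₂ ht₁ ht₂ hx1 hx2]
        exact L_coords_point hy hE ht₁ ht₂ hx1 hx2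
  -- kernel in `2E(K1)`
  have hker : ∀ P, ψ P = 0 → ∃ Q, P = 2 • Q := by
    intro P hP0
    suffices hδ : twoDescentMap h P = 0 by
      have hmem : P ∈ (twoDescentMap h).ker := hδ
      rw [ker_twoDescentMap h] at hmem
      obtain ⟨Q, hQ⟩ := hmem
      exact ⟨Q, hQ.symm⟩
    rcases P with _ | ⟨x, y, hP⟩
    · rfl
    · by_cases hx₁ : x = 0
      · exfalso; subst hx₁; rw [ψ_x0 hP] at hP0; exact absurd hP0 (by decide)
      by_cases hx₂ : x = -2 * 2993
      · exfalso; subst hx₂; rw [ψ_x2 hP] at hP0; exact absurd hP0 (by decide)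
      have hy : y ≠ 0 := by
        rintro rfl
        rcases x_eq_of_y_eq_zero hP with h0 | h0 | h0
        · exact hx₁ h0
        · exact hx₂ h0
        · subst h0; rw [ψ_x3 hP] at hP0; exact absurd hP0 (by decide)
      have hE := (nonsingular_iff_E' x y).mp hP
      obtain ⟨a₁, e₁, t₁, a₂, e₂, t₂, ht₁, ha₁, he₁, hx1, ht₂, ha₂, he₂, hx2⟩ := exists_coords_point hy hE
      rw [ψ_some hP hx₁ hx₂ ht₁ ht₂ hx1 hx2, Prod.mk_eq_zero] at hP0
      obtain ⟨z1, z2⟩ := hP0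
      obtain ⟨rfl, rfl⟩ := eq_zero_of_coords_eq_zero ha₁ he₁ z1
      obtain ⟨rfl, rfl⟩ := eq_zero_of_coords_eq_zero ha₂ he₂ z2
      rw [pow_zero, one_mul, genProd_zero, map_one, one_mul] at hx1 hx2
      have hx : x ≠ 0 := hx₁
      have hx₂' : x + 2 * 2993 ≠ 0 := by rw [hx2]; exact pow_ne_zero 2 ht₂
      rw [twoDescentMap_apply, twoDescentComponent_some_of_ne hP hx₁, twoDescentComponent_some_of_ne hP hx₂,
        sub_zero, show x - -2 * 2993 = x + 2 * 2993 by ring,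
        (sqClass_eq_one_iff hx).mpr ⟨t₁, hx1⟩, (sqClass_eq_one_iff hx₂').mpr ⟨t₂, hx2⟩]
      rfl
  -- torsion and values
  obtain ⟨ca₁, -, ca₃, -, -⟩ := coeffs_E'
  have hY : ∀ e : K1, (E').toAffine.twoTorsionY e = (E').toAffine.negY e ((E').toAffine.twoTorsionY e) := by
    intro e
    rw [WeierstrassCurve.Affine.negY, twoTorsionY, show (E').toAffine.a₁ = (E').a₁ from rfl,
      show (E').toAffine.a₃ = (E').a₃ from rfl, ca₁, ca₃]
    ring
  have hfin₁ : IsOfFinAddOrder T₁ := by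
    refine isOfFinAddOrder_iff_nsmul_eq_zero.mpr ⟨2, two_pos, ?_⟩
    rw [two_nsmul, hT₁]
    exact add_self_of_Y_eq (hY _)
  have hfin₂ : IsOfFinAddOrder T₂ := by
    refine isOfFinAddOrder_iff_nsmul_eq_zero.mpr ⟨2, two_pos, ?_⟩
    rw [two_nsmul, hT₂]
    exact add_self_of_Y_eq (hY _)
  have h₁ : ψ T₁ ≠ 0 := by rw [hT₁, ψ_x0]; decide
  have h₂ : ψ T₂ ≠ 0 := by rw [hT₂, ψ_x2]; decide
  have h₃ : ψ (T₁ + T₂) ≠ 0 := by rw [map_add, hT₁, hT₂, ψ_x0, ψ_x2]; decide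
  have h₁₂ : ψ T₁ ≠ ψ T₂ := by rw [hT₁, hT₂, ψ_x0, ψ_x2]; decide
  exact mordellWeilRank_le_of_range_subset ψ hker hfin₁ hfin₂ h₁ h₂ h₃ h₁₂ TK hsub (r := 3)
    (card_TK_le.trans (by norm_num))

end Descent2993

/-- **`rk E^{(2993)}(ℚ(√-1)) ≤ 3` for `E = 480a1`**, restated at the namespace level in the form of the
hypothesis `hU2993` of `descent_480a1_F4_of_upper_bounds` / `rank_480a1_F4_of_upper_bounds`.
[cite: DokchitserDokchitser2011RankModN, proof of Thm. 2] -/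
theorem mordellWeilRank_twist2993_K1_le :
    ((curve480a1.quadraticTwist 2993).baseChange K1).mordellWeilRank ≤ 3 :=
  Descent2993.mordellWeilRank_le_three


end DokchitserDokchitser2011

end Literature.Barriers.BirchSwinnertonDyer

end
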